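import Mathlib
import HarnessLib
import Summits.ValiantsHypothesis.ValiantsHypothesis.Theorems.LacunarySymmetroidMatrixDescartesProductPlusOneSeparatingWeight
import Summits.ValiantsHypothesis.ValiantsHypothesis.Theorems.LacunarySymmetroidMatrixDescartesProductPlusOneCrossingBudgetLocal

/-!
# ValiantsHypothesis / LacunarySymmetroid — crux `MatrixDescartes` (stmt-ValiantsHypothesis-18050, V1),
# LINE (A) «product_plus_one», floor `OneChangeFloorK3`: WINDOW form of the separating-weight law and the ORDERED-WINDOW LAW

Local companion of ✓ `…ProductPlusOneSeparatingWeight` (global law: a separating weight at EVERY positive zero ⇒ `Z₊(E) ≤ 2Z₊(P)+1`).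
Via the local crossing budget ✓ `euler_roots_Icc_le_one_of_down` the same pointwise criterion bounds the zeros on ONE pole-free
window, which is how the floor's interval-by-interval bookkeeping (✓ `…UnswitchedWindow`, `…SwitchedWindow`, `…ConflictWindow`,
`…FewPullers`) consumes it:

* ★ `sepWeight_window_le_one` (every format, any rows, any level): on a pole-free window `[u,v] ⊂ (0,∞)`, if at every zero of
  `E = X·P′ − C ν·P` in the window some weight `λ` and shifts `c_j` (`Σ c_j = ν`) separate the rows, then `E` has at most ONE zero there;
* `sepWeight_exists_pivot_of_ratioOrder` (K = 3, pure incoherent rows): at a point where every switched row has middle/top ratio at least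
  that of every unswitched row, a pivot `β ≥ 0` with `g_j·(β c_j − b_j) ≤ 0` for all rows exists (the selection step of
  ✓ `sepWeight_ratioOrdered_incoherent`, isolated for re-use);
* ★★ `sepWeight_orderedWindow_le_one` — THE ORDERED-WINDOW LAW (K = 3, bottom coupling, normalised chart, EVERY support ratio): on a
  pole-free window of a pure `(+,−,−)` company on which, pointwise, every switched row is at least as middle-heavy (`|b|/|c|`) as every
  unswitched row, `X·P′` has at most ONE zero.  In particular on the gap `(ρ_k, ρ_{k+1})` between consecutive zeros of the rows: if the
  `k` switched rows all have `|b|/|c|` ≥ those of the `m − k` unswitched rows, the gap carries exactly its one forced critical point —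
  no ratio window (compare ✓ `…ConflictWindow`: bottom weight needs no riser in its balance zone, top weight no far puller; here ONE
  intermediate weight per point suffices, and it exists under the ratio order whatever the phases).

HONEST FRAMING: window cells of the research floor `stub_oneChangeFloorK3`; NOT the stub, not `MatrixDescartes`; `VP ≠ VNP` is NOT
proved.  No definitions, no named facts, no sorry.
-/

set_option linter.dupNamespace false

namespace Summit.ValiantsHypothesis.ValiantsHypothesis.Theorems.LacunarySymmetroidMatrixDescartes

namespace ProductPlusOne

open Polynomial Finset
open scoped BigOperators

/-! ### §1 The window form of the separating-weight law (every format) -/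

/-- ★ **SEPARATING WEIGHT ON A WINDOW** (every format, any rows, any level): on a pole-free window `[u,v] ⊂ (0,∞)`, if at every
zero `t` of `E` in the window some weight `λ` and shifts `c_j` with `Σ c_j = ν` satisfy `W_j(t) < λ·f_j(t)·(θf_j(t) − c_j f_j(t))` for every
row, then `E` has at most one zero in `[u,v]` (✓ `euler_roots_Icc_le_one_of_down`). [this file's theorem] -/
theorem sepWeight_window_le_one {m : ℕ} (f : Fin m → ℝ[X]) (ν : ℝ) {u v : ℝ} (hu : 0 < u)
    (hP : ∀ t ∈ Set.Icc u v, (∏ j, f j).eval t ≠ 0)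
    (hsep : ∀ t ∈ Set.Icc u v, (X * derivative (∏ j, f j) - C ν * ∏ j, f j).eval t = 0 →
      ∃ lam : ℝ, ∃ c : Fin m → ℝ, (∑ j, c j = ν) ∧ ∀ j, (f j * (X * derivative (X * derivative (f j))) - (X * derivative (f j)) ^ 2).eval t < lam * ((f j).eval t * ((X * derivative (f j)).eval t - c j * (f j).eval t))) :
    ((X * derivative (∏ j, f j) - C ν * ∏ j, f j).roots.toFinset.filter (fun t => u ≤ t ∧ t ≤ v)).card ≤ 1 := by
  classical
  rcases Nat.eq_zero_or_pos m with hm | hm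
  · subst hm
    have hE : ((X * derivative (∏ j, f j) - C ν * ∏ j, f j) : ℝ[X]) = C (-ν) := by
      simp [map_neg]
    rw [hE, roots_C, Multiset.toFinset_zero, Finset.filter_empty, Finset.card_empty]
    exact Nat.zero_le _
  refine euler_roots_Icc_le_one_of_down f ν hP (fun t ht hEt => ?_)
  have ht0 : 0 < t := hu.trans_le ht.1
  have hfz : ∀ i, (f i).eval t ≠ 0 := by
    intro i hi
    apply hP t ht
    rw [eval_prod]
    exact Finset.prod_eq_zero (Finset.mem_univ i) hi
  obtain ⟨lam, c, hc, hrow⟩ := hsep t ht hEt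
  have h := sepWeight_crossing_neg hm f ν t lam c hc hEt hfz hrow
  -- `t·(E′(t)·P(t)) < 0` with `t > 0`
  rw [mul_assoc] at h
  rcases lt_or_ge ((derivative (X * derivative (∏ j, f j) - C ν * ∏ j, f j)).eval t * (∏ j, f j).eval t) 0 with hlt | hge
  · exact hlt
  · exact absurd h (not_lt.mpr (mul_nonneg ht0.le hge))

/-! ### §2 K = 3: the pivot selection and the ordered-window law -/

/-- **Pivot selection** (K = 3, pure incoherent rows `a_j > 0`, `b_j, c_j < 0`, at a point `t > 0` off the poles): if every switched row
(`g_j(t) < 0`) has `b_i·c_j ≤ b_j·c_i` against every unswitched row `i` (`g_i(t) > 0`) — i.e. `|b_j|/|c_j| ≥ |b_i|/|c_i|` — then some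
`β ≥ 0` has `g_j(t)·(β c_j − b_j) ≤ 0` and `θg_j(t) ≠ 0` for every row. [this file's lemma] -/
theorem sepWeight_exists_pivot_of_ratioOrder {m : ℕ} (a b c : Fin m → ℝ) (e k : ℕ)
    (hinc : ∀ j, 0 < a j ∧ b j < 0 ∧ c j < 0) {t : ℝ} (ht : 0 < t) (hg : ∀ j, (a j + b j * t ^ (e + 1) + c j * t ^ (e + k + 2)) ≠ 0)
    (hord : ∀ j i, (a j + b j * t ^ (e + 1) + c j * t ^ (e + k + 2)) < 0 → 0 < (a i + b i * t ^ (e + 1) + c i * t ^ (e + k + 2)) → b i * c j ≤ b j * c i) :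
    ∃ β : ℝ, 0 ≤ β ∧ ∀ j, (a j + b j * t ^ (e + 1) + c j * t ^ (e + k + 2)) * (β * c j - b j) ≤ 0 ∧ (((e : ℝ) + 1) * b j * t ^ (e + 1) + ((e : ℝ) + k + 2) * c j * t ^ (e + k + 2)) ≠ 0 := by
  classical
  have hN : ∀ j, (((e : ℝ) + 1) * b j * t ^ (e + 1) + ((e : ℝ) + k + 2) * c j * t ^ (e + k + 2)) ≠ 0 := by
    intro j
    have h1 : ((e : ℝ) + 1) * b j * t ^ (e + 1) < 0 :=
      mul_neg_of_neg_of_pos (mul_neg_of_pos_of_neg (by positivity) (hinc j).2.1) (by positivity)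
    have h2 : ((e : ℝ) + k + 2) * c j * t ^ (e + k + 2) < 0 :=
      mul_neg_of_neg_of_pos (mul_neg_of_pos_of_neg (by positivity) (hinc j).2.2) (by positivity)
    linarith
  set S : Finset (Fin m) := Finset.univ.filter (fun j => (a j + b j * t ^ (e + 1) + c j * t ^ (e + k + 2)) < 0) with hS
  by_cases hSne : S.Nonempty
  · obtain ⟨j₀, hj₀, hmin⟩ := S.exists_min_image (fun j => b j / c j) hSne
    have hj₀' : a j₀ + b j₀ * t ^ (e + 1) + c j₀ * t ^ (e + k + 2) < 0 := (Finset.mem_filter.mp hj₀).2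
    refine ⟨b j₀ / c j₀, le_of_lt (div_pos_of_neg_of_neg (hinc j₀).2.1 (hinc j₀).2.2), fun j => ⟨?_, hN j⟩⟩
    rcases lt_or_gt_of_ne (hg j) with hlt | hgt
    · have hle : b j₀ / c j₀ ≤ b j / c j := hmin j (Finset.mem_filter.mpr ⟨Finset.mem_univ _, hlt⟩)
      have h1 : b j ≤ b j₀ / c j₀ * c j := (le_div_iff_of_neg (hinc j).2.2).mp hle
      nlinarith
    · have hle : b j * c j₀ ≤ b j₀ * c j := hord j₀ j hj₀' hgt
      have h1 : b j₀ / c j₀ * c j ≤ b j := by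
        rw [div_mul_eq_mul_div, div_le_iff_of_neg (hinc j₀).2.2]
        exact hle
      nlinarith
  · rcases Nat.eq_zero_or_pos m with hm | hm
    · subst hm
      exact ⟨0, le_rfl, fun j => j.elim0⟩
    obtain ⟨j₁, -, hmax⟩ := Finset.univ.exists_max_image (fun j => b j / c j) ⟨⟨0, hm⟩, Finset.mem_univ _⟩
    refine ⟨b j₁ / c j₁, le_of_lt (div_pos_of_neg_of_neg (hinc j₁).2.1 (hinc j₁).2.2), fun j => ⟨?_, hN j⟩⟩
    have hgt : 0 < (a j + b j * t ^ (e + 1) + c j * t ^ (e + k + 2)) := by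
      rcases lt_or_gt_of_ne (hg j) with hlt | hgt
      · exact absurd ⟨j, Finset.mem_filter.mpr ⟨Finset.mem_univ _, hlt⟩⟩ hSne
      · exact hgt
    have hle : b j / c j ≤ b j₁ / c j₁ := hmax j (Finset.mem_univ _)
    have h1 : b j₁ / c j₁ * c j ≤ b j := (div_le_iff_of_neg (hinc j).2.2).mp hle
    nlinarith

/-- ★★ **THE ORDERED-WINDOW LAW** (K = 3, bottom coupling, normalised chart `g_j = a_j + b_j X^{e+1} + c_j X^{e+k+2}`, pure incoherent
company `a_j > 0`, `b_j, c_j < 0`, EVERY support): on a pole-free window `[u,v] ⊂ (0,∞)` on which, at every point, every switched row has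
middle/top ratio at least that of every unswitched row (`g_j(t) < 0`, `g_i(t) > 0 ⇒ b_i c_j ≤ b_j c_i`), `X·P′` has at most ONE zero.
[this file's theorem] -/
theorem sepWeight_orderedWindow_le_one {m : ℕ} (a b c : Fin m → ℝ) (e k : ℕ)
    (hinc : ∀ j, 0 < a j ∧ b j < 0 ∧ c j < 0) {u v : ℝ} (hu : 0 < u)
    (hfree : ∀ t ∈ Set.Icc u v, ∀ j, (a j + b j * t ^ (e + 1) + c j * t ^ (e + k + 2)) ≠ 0)
    (hord : ∀ t ∈ Set.Icc u v, ∀ j i, (a j + b j * t ^ (e + 1) + c j * t ^ (e + k + 2)) < 0 → 0 < (a i + b i * t ^ (e + 1) + c i * t ^ (e + k + 2)) → b i * c j ≤ b j * c i) :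
    ((X * derivative (∏ j, (C (a j) + C (b j) * X ^ (e + 1) + C (c j) * X ^ (e + k + 2))) - C (0 : ℝ) * (∏ j, (C (a j) + C (b j) * X ^ (e + 1) + C (c j) * X ^ (e + k + 2))) : ℝ[X]).roots.toFinset.filter (fun t => u ≤ t ∧ t ≤ v)).card ≤ 1 := by
  classical
  have hP : ∀ t ∈ Set.Icc u v, (∏ j, (C (a j) + C (b j) * X ^ (e + 1) + C (c j) * X ^ (e + k + 2)) : ℝ[X]).eval t ≠ 0 := by
    intro t ht
    rw [eval_prod, Finset.prod_ne_zero_iff]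
    intro j _
    have h := hfree t ht j
    simpa only [eval_add, eval_mul, eval_C, eval_pow, eval_X] using h
  refine sepWeight_window_le_one (fun j => (C (a j) + C (b j) * X ^ (e + 1) + C (c j) * X ^ (e + k + 2))) 0 hu hP (fun t ht _hEt => ?_)
  have ht0 : 0 < t := hu.trans_le ht.1
  obtain ⟨β, hβ, hrow⟩ := sepWeight_exists_pivot_of_ratioOrder a b c e k hinc ht0 (hfree t ht) (hord t ht)
  set Xv : ℝ := t ^ (e + 1) with hXv
  set Yv : ℝ := t ^ (e + k + 2) with hYv
  set p : ℝ := (e : ℝ) + 1 with hpdef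
  set q : ℝ := (e : ℝ) + k + 2 with hqdef
  refine ⟨(p ^ 2 * β * Xv + q ^ 2 * Yv) / (p * β * Xv + q * Yv), fun _ => 0, by simp, fun j => ?_⟩
  rw [sepWeight_eval_wronskian, sepWeight_eval_theta]
  simp only [eval_add, eval_mul, eval_C, eval_pow, eval_X, zero_mul, sub_zero]
  have hp : 0 < p := by rw [hpdef]; positivity
  have hpq : p < q := by rw [hpdef, hqdef]; have : (0:ℝ) ≤ k := Nat.cast_nonneg k; linarith
  have hX : 0 < Xv := by rw [hXv]; positivity
  have hY : 0 < Yv := by rw [hYv]; positivity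
  exact sepWeight_row_neg hp hpq hX hY hβ (hrow j).1 (hrow j).2

end ProductPlusOne

end Summit.ValiantsHypothesis.ValiantsHypothesis.Theorems.LacunarySymmetroidMatrixDescartes
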